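import Literature.AnabelianGeometry.AbsoluteAnabelian.MLFReciprocityInputs
import Literature.AnabelianGeometry.AbsoluteAnabelian.LocalInertiaTorsionFreeProofs
import Literature.AnabelianGeometry.AbsoluteAnabelian.MLFGaloisGroupsProofs
import Literature.AnabelianGeometry.AbsoluteAnabelian.GaloisSubextensionProofs
import Literature.NumberTheory.GaloisRepresentations.LocalReciprocityProofs
import Literature.NumberTheory.GaloisRepresentations.LocalClassFieldTheoryProofs
import Literature.NumberTheory.GaloisRepresentations.WeilGroupDensityProofs
import Literature.NumberTheory.GaloisRepresentations.LocalFieldFiniteExtension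
import Literature.NumberTheory.GaloisRepresentations.LocalFieldPadicProofs
import HarnessLib

/-!
# Discharge of `mlf_torsion_card` ([AbsAnab] Prop 1.2.1 (iii)/(v): "`Im(k^×)` is the prime-to-`p`
# torsion of `G_K^ab`") from the tree's local class field theory

The named fact `mlf_torsion_card` (`MLFReciprocityInputs.lean`, ℚ_p-binder model of
`MLFGaloisGroups.lean`): for an MLF `K/ℚ_p`, the prime-to-`p` torsion elements of
`G_K^ab = Field.absoluteGaloisGroupAbelianization K` are equinumerous with the prime-to-`p` roots
of unity of `K`.  S. Mochizuki, *The Absolute Anabelian Geometry of Hyperbolic Curves* (2004)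
[AbsAnab], proof of Prop 1.2.1, p. 11: "`Im(k^×_i)` may be recovered as the prime-to-`p` torsion
subgroup of `G^ab_{K_i}`" — by local class field theory.

PROVED here (`mlf_torsion_card_holds`), from theorems of the tree:
* the model bridge "a finite extension of `ℚ_p` is a non-archimedean local field"
  (`Padic.isNonarchimedeanLocalField_holds`, `FiniteExtension.isNonarchimedeanLocalField`);
* Serre's reciprocity map `θ : K^× → G_K^ab` (`exists_isLocalReciprocityMap_holds`: injective,
  `θ(U_K) =` image of the inertia group `I_K`);
* `closure [G_K, G_K] ≤ I_K` (`WeilGroup.topologicalClosure_commutator_absGalois_le_absInertia`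
  with `WeilGroup.denseRange_toAbsGalois_holds`);
* `G_K/I_K` is torsion-free (`mem_absInertia_of_pow_mem`, `LocalInertiaTorsionFreeProofs.lean`).
The bijection is `ζ ↦ θ(ζ)`: a prime-to-`p` torsion class `[σ]` has `σ^n ∈ closure [G_K,G_K] ≤ I_K`,
hence `σ ∈ I_K`, so `[σ] = θ(u)` with `u ∈ U_K`, `u^n = 1` by injectivity.

Also `mlf_torsion_card_subextension_holds`: the same count for `Gal(K̄/E)^ab`, `E ⊆ K̄` a finite
subextension, by transport along `Gal(K̄/E) ≅ G_E` (`GaloisSubextensionProofs.lean`) and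
`mlf_torsion_card_holds` for the MLF `E`.

Proof-only: no definitions.  With this, Prop 1.2.1 (v) (`galoisMLF_iso_degrees_of_rank_of_torsion`,
`MLFGaloisGroupsProofs.lean`) depends only on the rank formula `thm26_ii_delta_gal`, and Prop 1.2.1
(ii) (`MLFInertiaProofs.lean`) only on it and `mlf_unramified_criterion`.
-/

noncomputable section

namespace Literature.AnabelianGeometry.AbsoluteAnabelian

open Field
open Literature.NumberTheory.GaloisRepresentations

/-- **`mlf_torsion_card` holds**: for an MLF `K/ℚ_p`, the prime-to-`p` torsion elements of
`G_K^ab` are equinumerous with the prime-to-`p` roots of unity of `K` — by local class field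
theory as proved in the tree (reciprocity map, `θ(U_K) = [I_K]`, `closure [G_K,G_K] ≤ I_K`,
`G_K/I_K` torsion-free). [cite: MochizukiAbsAnab2004, Prop 1.2.1 (iii) proof p.11] -/
theorem mlf_torsion_card_holds : mlf_torsion_card := by
  intro p _ K _ _ _
  classical
  -- the valued structure of `K` as a finite extension of `ℚ_p`
  haveI : IsNonarchimedeanLocalField ℚ_[p] := Padic.isNonarchimedeanLocalField_holds p
  letI := FiniteExtension.normedField ℚ_[p] K
  letI := FiniteExtension.valuativeRel ℚ_[p] K
  haveI : IsNonarchimedeanLocalField K := FiniteExtension.isNonarchimedeanLocalField ℚ_[p] K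
  -- the reciprocity map and the inertia facts
  obtain ⟨θ, hθ⟩ := exists_isLocalReciprocityMap_holds K
  have hCI : (commutator (absoluteGaloisGroup K)).topologicalClosure ≤ absInertia K :=
    WeilGroup.topologicalClosure_commutator_absGalois_le_absInertia
      (WeilGroup.denseRange_toAbsGalois_holds K)
  -- the map `ζ ↦ θ ζ`
  have hne : ∀ ζ : K, ζ ∈ primeToRootsOfUnity p K → ζ ≠ 0 := by
    rintro ζ ⟨n, hn, -, hζ⟩ h0
    rw [h0, zero_pow hn.ne'] at hζ
    exact zero_ne_one hζ
  let Φ : primeToRootsOfUnity p K → primeToRootsOfUnity p (absoluteGaloisGroupAbelianization K) :=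
    fun ζ => ⟨θ (Units.mk0 ζ.1 (hne ζ.1 ζ.2)), by
      obtain ⟨n, hn, hpn, hζ⟩ := ζ.2
      refine ⟨n, hn, hpn, ?_⟩
      rw [← map_pow]
      have : (Units.mk0 ζ.1 (hne ζ.1 ζ.2)) ^ n = 1 := by ext; simp [hζ]
      rw [this, map_one]⟩
  refine (Nat.card_congr (Equiv.ofBijective Φ ⟨?_, ?_⟩)).symm
  · -- injective
    intro ζ₁ ζ₂ h
    have h1 := congrArg Subtype.val h
    have h2 := hθ.injective h1
    exact Subtype.ext (by simpa using congrArg (fun u : Kˣ => (u : K)) h2)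
  · -- surjective: a prime-to-`p` torsion class lies in `[I_K] = θ(U_K)`
    rintro ⟨t, n, hn, hpn, htn⟩
    obtain ⟨σ, rfl⟩ := QuotientGroup.mk_surjective t
    have hσn : σ ^ n ∈ absInertia K := by
      apply hCI
      rw [← QuotientGroup.eq_one_iff, QuotientGroup.mk_pow]
      exact htn
    have hσ : σ ∈ absInertia K := mem_absInertia_of_pow_mem hn hσn
    have hmem : (QuotientGroup.mk σ : absoluteGaloisGroupAbelianization K) ∈
        ((absInertia K).map (absGaloisAbProj K)) := ⟨σ, hσ, rfl⟩
    rw [← hθ.map_unitGroup] at hmem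
    obtain ⟨u, -, hu⟩ := hmem
    have hun : u ^ n = 1 := by
      apply hθ.injective
      rw [map_pow, hu, map_one, ← QuotientGroup.mk_pow]
      exact htn
    have hu0 : (u : K) ≠ 0 := u.ne_zero
    refine ⟨⟨(u : K), n, hn, hpn, by rw [← Units.val_pow_eq_pow_val, hun, Units.val_one]⟩, ?_⟩
    apply Subtype.ext
    change θ (Units.mk0 (u : K) _) = QuotientGroup.mk σ
    rw [← hu]
    congr 1
    exact Units.ext rfl

/-- An isomorphism of monoids preserves the number of prime-to-`p` roots of unity. [folklore] -/
private theorem natCard_primeToRootsOfUnity_congr'' {M N : Type*} [Monoid M] [Monoid N]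
    (e : M ≃* N) (p : ℕ) :
    Nat.card (primeToRootsOfUnity p M) = Nat.card (primeToRootsOfUnity p N) := by
  have himage : e '' primeToRootsOfUnity p M = primeToRootsOfUnity p N := by
    ext y
    constructor
    · rintro ⟨x, ⟨n, hn, hpn, hx⟩, rfl⟩
      exact ⟨n, hn, hpn, by rw [← map_pow, hx, map_one]⟩
    · rintro ⟨n, hn, hpn, hy⟩
      refine ⟨e.symm y, ⟨n, hn, hpn, ?_⟩, e.apply_symm_apply y⟩
      rw [← map_pow, hy, map_one]
  rw [← himage, Nat.card_image_of_injective e.injective]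

/-- **`mlf_torsion_card_subextension` holds**: for an MLF `K/ℚ_p` and a finite subextension
`E ⊆ K̄`, the prime-to-`p` torsion elements of `Gal(K̄/E)^ab` are equinumerous with the
prime-to-`p` roots of unity of `E` — transport along `Gal(K̄/E) ≅ G_E`
(`nonempty_continuousMulEquiv_fixingSubgroup`) and `mlf_torsion_card_holds` for the MLF `E`.
[cite: MochizukiAbsAnab2004, Prop 1.2.1 (iv) proof p.11] -/
theorem mlf_torsion_card_subextension_holds : mlf_torsion_card_subextension := by
  intro p _ K _ _ _ E _
  haveI : CharZero K := charZero_of_injective_algebraMap (algebraMap ℚ_[p] K).injective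
  haveI : FiniteDimensional ℚ_[p] E := Module.Finite.trans K E
  obtain ⟨e⟩ := nonempty_continuousMulEquiv_fixingSubgroup K E
  obtain ⟨ê, -⟩ := exists_mulEquiv_topologicalAbelianization e
  rw [natCard_primeToRootsOfUnity_congr'' ê p]
  exact mlf_torsion_card_holds p E

end Literature.AnabelianGeometry.AbsoluteAnabelian
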